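import Mathlib
import Summits.RiemannHypothesis.RiemannHypothesis.Theorems.SignConeConeMagnificationDesignClassFacts

/-!
# Crux `SignCone.ConeMagnification` (stmt-RiemannHypothesis-16303), line `Sketch` r8, stub `stub_designOfTypes`:
# Step 2 — deficit extraction at a finite level

Seat-0 programme for the open core `stub_designOfTypes` (design algebra §3).  For finite sets of primes `D ⊆ Q`, the
killer/excluder designs rotated by `ω_j = −exp(2π i j/N)` (`N = |D| + 2`), the type inequalities, the touching
decomposition and the discrete Fejér averaging give

  `deficit_finset_le_level`:
  `Σ_{p∈D} (log p − c(p))/√p ≤ 12 − 24 C₁ + Σ_{p∈D} √p · X_p(Q)`,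
  `X_p(Q) = Σ'_{n : p ∣ n, p² ∤ n, n ≠ p, no other prime of Q divides n} c(n)/n`

(the pollution `X_p(Q)` is a tail of the convergent `Σ_{p∣n} c(n)/n` when `Q` is all primes `≤ z`, Step 3).
-/

noncomputable section

-- `Summit.RiemannHypothesis.RiemannHypothesis.…` repeats a namespace component by design (D-0017 layout).
set_option linter.dupNamespace false

open Finset Filter Complex
open scoped BigOperators ComplexConjugate Topology Real

namespace Summit.RiemannHypothesis.RiemannHypothesis.Theorems.SignConeConeMagnification

namespace Design

/-! ### Step 2 -/

/-- **Step 2: deficit extraction at level `Q`** (seat-0, design algebra §3).  Under Loc and TI, for finite sets of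
primes `D ⊆ Q` and the limit `C₁ ≤ 1/2` of the partial sums of `(c(n) − Λ(n))/n`:
`Σ_{p∈D} (log p − c(p))/√p ≤ 12 − 24 C₁ + Σ_{p∈D} √p · X_p(Q)` with the pollution
`X_p(Q) = Σ'_{n : p ∣ n, p² ∤ n, n ≠ p, every prime of Q dividing n equals p} c(n)/n`. [folklore] -/
theorem deficit_finset_le_level (c : ℕ → ℝ) (hc0 : ∀ n, 0 ≤ c n)
    (hLoc : ∀ p : ℕ, p.Prime → Summable (fun n : ℕ => if p ∣ n then c n / n else 0))
    (hTI : ∀ α : ℕ → ℂ, ∀ L : ℕ, (∀ m, L < m → α m = 0) →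
      ∃ T : ℝ, Tendsto (fun x : ℝ => ∑ n ∈ Finset.Icc 1 ⌊x⌋₊,
          (c n - ArithmeticFunction.vonMangoldt n) / n *
            (∑ ℓ ∈ Finset.Icc 1 L, ∑ ℓ' ∈ Finset.Icc 1 L, α ℓ * (starRingEnd ℂ) (α ℓ') *
            (((Nat.gcd (n * ℓ') ℓ : ℕ) : ℝ) : ℂ) / (Real.sqrt ((ℓ : ℝ) * ℓ') : ℂ)).re) atTop (𝓝 T) ∧
        T ≤ 1 / 2 * (∑ ℓ ∈ Finset.Icc 1 L, ∑ ℓ' ∈ Finset.Icc 1 L, α ℓ * (starRingEnd ℂ) (α ℓ') *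
            (((Nat.gcd (1 * ℓ') ℓ : ℕ) : ℝ) : ℂ) / (Real.sqrt ((ℓ : ℝ) * ℓ') : ℂ)).re)
    (C₁ : ℝ) (hC₁ : Tendsto (fun x : ℝ => ∑ n ∈ Finset.Icc 1 ⌊x⌋₊,
        (c n - ArithmeticFunction.vonMangoldt n) / n) atTop (𝓝 C₁)) (hC₁le : C₁ ≤ 1 / 2)
    (Q D : Finset ℕ) (hQ : ∀ q ∈ Q, q.Prime) (hDQ : D ⊆ Q) :
    ∑ p ∈ D, (Real.log p - c p) / Real.sqrt p ≤
      12 - 24 * C₁ + ∑ p ∈ D, Real.sqrt p *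
        ∑' n : ℕ, (if p ∣ n ∧ ¬ p ^ 2 ∣ n ∧ n ≠ p ∧ (∀ q ∈ Q, q ∣ n → q = p) then c n / n else 0) := by
  classical
  -- the pollution series are nonnegative and summable
  have hXs : ∀ p ∈ D, Summable (fun n : ℕ =>
      (if p ∣ n ∧ ¬ p ^ 2 ∣ n ∧ n ≠ p ∧ (∀ q ∈ Q, q ∣ n → q = p) then c n / n else 0)) := by
    intro p hp
    refine Summable.of_nonneg_of_le (fun n => ?_) (fun n => ?_) (hLoc p (hQ p (hDQ hp)))
    · by_cases h : p ∣ n ∧ ¬ p ^ 2 ∣ n ∧ n ≠ p ∧ (∀ q ∈ Q, q ∣ n → q = p)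
      · rw [if_pos h]; exact div_nonneg (hc0 n) (Nat.cast_nonneg _)
      · rw [if_neg h]
    · by_cases h : p ∣ n ∧ ¬ p ^ 2 ∣ n ∧ n ≠ p ∧ (∀ q ∈ Q, q ∣ n → q = p)
      · rw [if_pos h, if_pos h.1]
      · rw [if_neg h]
        by_cases h' : p ∣ n
        · rw [if_pos h']; exact div_nonneg (hc0 n) (Nat.cast_nonneg _)
        · rw [if_neg h']
  have hX0 : ∀ p ∈ D, 0 ≤ ∑' n : ℕ,
      (if p ∣ n ∧ ¬ p ^ 2 ∣ n ∧ n ≠ p ∧ (∀ q ∈ Q, q ∣ n → q = p) then c n / n else 0) := by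
    intro p hp
    refine tsum_nonneg fun n => ?_
    by_cases h : p ∣ n ∧ ¬ p ^ 2 ∣ n ∧ n ≠ p ∧ (∀ q ∈ Q, q ∣ n → q = p)
    · rw [if_pos h]; exact div_nonneg (hc0 n) (Nat.cast_nonneg _)
    · rw [if_neg h]
  -- the empty case
  rcases D.eq_empty_or_nonempty with hDe | hDne
  · subst hDe
    simp only [Finset.sum_empty, add_zero]
    linarith
  -- notation
  set N : ℕ := D.card + 2 with hN
  have hN3 : 3 ≤ N := by
    have := Finset.card_pos.2 hDne
    omega
  have hN0 : (0 : ℝ) < N := by positivity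
  set θ : ℕ → ℝ := fun j => 2 * π * j / N with hθ
  set w : ℕ → ℝ := fun j => 1 + Real.cos (θ j) with hw
  have hw0 : ∀ j, 0 ≤ w j := fun j => one_add_cos_nonneg _
  set P : ℕ → ℝ := fun n => ∏ p ∈ D.filter (· ∣ n), Real.sqrt p / 2 with hP
  set B : ℝ := ∏ p ∈ D, (1 + Real.sqrt p / 2) with hB
  have hPB : ∀ n, P n ≤ B := fun n => prod_sqrt_half_le (Finset.filter_subset _ _)
  have hP0 : ∀ n, 0 ≤ P n := fun n => Finset.prod_nonneg fun i _ => by positivity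
  -- the rotated profiles
  set ψ : ℕ → ℕ → ℝ := fun j n =>
    if (∀ q ∈ Q \ D, ¬ q ∣ n) ∧ (∀ p ∈ D, ¬ p ^ 2 ∣ n) then
      P n * ((-1) ^ (D.filter (· ∣ n)).card * Real.cos ((D.filter (· ∣ n)).card * θ j)) else 0 with hψdef
  -- (i) TI along each rotated design, decomposed along the `Q`-touching integers
  have key : ∀ j : ℕ, Summable (fun n : ℕ => if (∃ q ∈ Q, q ∣ n) then
        (c n - ArithmeticFunction.vonMangoldt n) / n * (ψ j n - 1) else 0) ∧
      C₁ + ∑' n : ℕ, (if (∃ q ∈ Q, q ∣ n) then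
        (c n - ArithmeticFunction.vonMangoldt n) / n * (ψ j n - 1) else 0) ≤ 1 / 2 := by
    intro j
    obtain ⟨α, L, K, hK, hsupp, hprof⟩ := gcdForm_killerDesign Q D hQ hDQ (fun p => Real.sqrt p / 2)
      (fun p _ => ⟨by positivity, le_rfl⟩) (-Complex.exp (θ j * I)) (rotUnit_ne_zero _) (conj_rotUnit _)
    set Z : ℕ → ℂ := fun n => (if (∀ q ∈ Q \ D, ¬ q ∣ n) ∧ (∀ p ∈ D, ¬ p ^ 2 ∣ n) then
      (∏ p ∈ D.filter (· ∣ n), ((Real.sqrt p / 2 : ℝ) : ℂ)) * (-Complex.exp (θ j * I)) ^ (D.filter (· ∣ n)).card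
      else 0) with hZdef
    obtain ⟨T, hT, hTle⟩ := tendsto_TI_profile c hTI α L K hK hsupp Z (fun n hn => hprof n hn)
    have hZre : ∀ n, (Z n).re = ψ j n := by
      intro n
      simp only [hZdef, hψdef]
      split_ifs
      · rw [← Complex.ofReal_prod, Complex.re_ofReal_mul, re_rotUnit_pow]
      · simp
    simp_rw [hZre] at hT hTle
    have hψ1 : ψ j 1 = 1 := by
      obtain ⟨p, hp⟩ := hDne
      have h1 : (∀ q ∈ Q \ D, ¬ q ∣ 1) ∧ (∀ p ∈ D, ¬ p ^ 2 ∣ 1) := by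
        refine ⟨fun q hq h => (hQ q (Finset.mem_sdiff.1 hq).1).one_lt.ne' (Nat.dvd_one.1 h), fun p hp h => ?_⟩
        have h3 : 1 < p ^ 2 := Nat.one_lt_pow two_ne_zero (hQ p (hDQ hp)).one_lt
        have := Nat.dvd_one.1 h
        omega
      simp only [hψdef, if_pos h1, filter_dvd_eq_empty (not_exists_prime_dvd_one (fun q hq => hQ q (hDQ hq))),
        Finset.card_empty, Finset.prod_empty, hP]
      simp
    rw [hψ1, mul_one] at hTle
    have hψc : ∀ n : ℕ, n ≠ 0 → (¬ ∃ q ∈ Q, q ∣ n) → ψ j n = 1 := by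
      intro n hn hnt
      have h1 : (∀ q ∈ Q \ D, ¬ q ∣ n) ∧ (∀ p ∈ D, ¬ p ^ 2 ∣ n) :=
        ⟨fun q hq h => hnt ⟨q, (Finset.mem_sdiff.1 hq).1, h⟩,
          fun p hp h => hnt ⟨p, hDQ hp, dvd_trans (dvd_pow_self p two_ne_zero) h⟩⟩
      have h2 : D.filter (· ∣ n) = ∅ :=
        filter_dvd_eq_empty fun ⟨q, hq, hqn⟩ => hnt ⟨q, hDQ hq, hqn⟩
      simp only [hψdef, if_pos h1, h2, Finset.card_empty, Finset.prod_empty, hP]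
      simp
    have hψB : ∀ n, |ψ j n| ≤ B := by
      intro n
      simp only [hψdef]
      split_ifs
      · rw [abs_mul, abs_mul, abs_pow, abs_neg, abs_one, one_pow, one_mul, abs_of_nonneg (hP0 n)]
        calc P n * |Real.cos ((D.filter (· ∣ n)).card * θ j)| ≤ P n * 1 :=
              mul_le_mul_of_nonneg_left (Real.abs_cos_le_one _) (hP0 n)
          _ ≤ B := by rw [mul_one]; exact hPB n
      · rw [abs_zero]
        exact Finset.prod_nonneg fun i _ => by positivity
    obtain ⟨hgs, hTeq⟩ := TI_touch_decomposition c hc0 hLoc Q hQ (ψ j) 1 B hψc hψB C₁ hC₁ T hT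
    refine ⟨hgs, ?_⟩
    rw [one_mul] at hTeq
    linarith
  -- (ii) the touching sum (Step 1) and the class-one series
  obtain ⟨hts, htle⟩ := touch_tsum_le c hc0 hLoc hTI C₁ hC₁ Q hQ
  set t : ℕ → ℝ := fun n => if (∃ q ∈ Q, q ∣ n) then (c n - ArithmeticFunction.vonMangoldt n) / n else 0
    with htdef
  set g : ℕ → ℕ → ℝ := fun j n => if (∃ q ∈ Q, q ∣ n) then
      (c n - ArithmeticFunction.vonMangoldt n) / n * (ψ j n - 1) else 0 with hgdef
  set Y : ℕ → ℝ := fun n => if ((∃ q ∈ Q, q ∣ n) ∧ ((∀ q ∈ Q \ D, ¬ q ∣ n) ∧ (∀ p ∈ D, ¬ p ^ 2 ∣ n)) ∧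
      (D.filter (· ∣ n)).card = 1) then (c n - ArithmeticFunction.vonMangoldt n) / n * P n else 0 with hYdef
  -- (iii) pointwise Fejér evaluation
  have hsumw : ∑ j ∈ Finset.range N, w j = N := fejerSum_weights N (by omega)
  have hG : ∀ n : ℕ, ∑ j ∈ Finset.range N, w j * g j n = -((N : ℝ) / 2) * Y n - N * t n := by
    intro n
    by_cases ht : ∃ q ∈ Q, q ∣ n
    · have hexp : ∀ j, w j * g j n = (c n - ArithmeticFunction.vonMangoldt n) / n * (w j * ψ j n) -
          (c n - ArithmeticFunction.vonMangoldt n) / n * w j := by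
        intro j; simp only [hgdef, if_pos ht]; ring
      simp_rw [hexp]
      rw [Finset.sum_sub_distrib, ← Finset.mul_sum, ← Finset.mul_sum, hsumw]
      simp only [htdef, if_pos ht]
      by_cases hs : (∀ q ∈ Q \ D, ¬ q ∣ n) ∧ (∀ p ∈ D, ¬ p ^ 2 ∣ n)
      · -- surviving: class size between 1 and N − 2
        have hk1 : 1 ≤ (D.filter (· ∣ n)).card := by
          obtain ⟨q, hq, hqn⟩ := ht
          by_cases hqD : q ∈ D
          · exact Finset.card_pos.2 ⟨q, Finset.mem_filter.2 ⟨hqD, hqn⟩⟩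
          · exact absurd hqn (hs.1 q (Finset.mem_sdiff.2 ⟨hq, hqD⟩))
        have hkN : (D.filter (· ∣ n)).card + 2 ≤ N := by
          have := Finset.card_filter_le D (· ∣ n)
          omega
        have hwψ : ∀ j, w j * ψ j n = (1 + Real.cos (2 * π * j / N)) *
            (P n * ((-1) ^ (D.filter (· ∣ n)).card * Real.cos ((D.filter (· ∣ n)).card * (2 * π * j / N)))) := by
          intro j; simp only [hw, hθ, hψdef, if_pos hs]
        simp_rw [hwψ]
        rw [fejer_class_sum N _ hk1 hkN (P n)]
        simp only [hYdef]
        by_cases hk : (D.filter (· ∣ n)).card = 1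
        · rw [if_pos hk, if_pos ⟨ht, hs, hk⟩]; ring
        · have hc : ¬ ((∃ q ∈ Q, q ∣ n) ∧ ((∀ q ∈ Q \ D, ¬ q ∣ n) ∧ (∀ p ∈ D, ¬ p ^ 2 ∣ n)) ∧
              (D.filter (· ∣ n)).card = 1) := fun h => hk h.2.2
          rw [if_neg hk, if_neg hc]; ring
      · -- killed or excluded: the profile vanishes
        have hwψ : ∀ j, w j * ψ j n = 0 := by
          intro j; simp only [hψdef, if_neg hs, mul_zero]
        simp_rw [hwψ]
        rw [Finset.sum_const_zero]
        have hc : ¬ ((∃ q ∈ Q, q ∣ n) ∧ ((∀ q ∈ Q \ D, ¬ q ∣ n) ∧ (∀ p ∈ D, ¬ p ^ 2 ∣ n)) ∧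
            (D.filter (· ∣ n)).card = 1) := fun h => hs h.2.1
        simp only [hYdef, if_neg hc]
        ring
    · have h0 : ∀ j, w j * g j n = 0 := fun j => by simp only [hgdef, if_neg ht, mul_zero]
      simp_rw [h0]
      rw [Finset.sum_const_zero]
      have hc : ¬ ((∃ q ∈ Q, q ∣ n) ∧ ((∀ q ∈ Q \ D, ¬ q ∣ n) ∧ (∀ p ∈ D, ¬ p ^ 2 ∣ n)) ∧
          (D.filter (· ∣ n)).card = 1) := fun h => ht h.1
      simp only [htdef, hYdef, if_neg ht, if_neg hc]
      ring
  -- (iv) summing the type inequalities with the Fejér weights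
  have hB0 : 0 ≤ B := Finset.prod_nonneg fun i _ => by positivity
  have hYs : Summable Y := by
    refine Summable.of_norm_bounded ((hts.abs).mul_left B) fun n => ?_
    rw [Real.norm_eq_abs]
    by_cases hY : (∃ q ∈ Q, q ∣ n) ∧ ((∀ q ∈ Q \ D, ¬ q ∣ n) ∧ (∀ p ∈ D, ¬ p ^ 2 ∣ n)) ∧
        (D.filter (· ∣ n)).card = 1
    · have h1 : Y n = (c n - ArithmeticFunction.vonMangoldt n) / n * P n := by simp only [hYdef, if_pos hY]
      have h2 : t n = (c n - ArithmeticFunction.vonMangoldt n) / n := by simp only [htdef, if_pos hY.1]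
      rw [h1, h2, abs_mul, abs_of_nonneg (hP0 n), mul_comm]
      exact mul_le_mul_of_nonneg_right (hPB n) (abs_nonneg _)
    · have h1 : Y n = 0 := by simp only [hYdef, if_neg hY]
      rw [h1, abs_zero]
      exact mul_nonneg hB0 (abs_nonneg _)
  have hcomb : (N : ℝ) * C₁ + ∑' n : ℕ, (-((N : ℝ) / 2) * Y n - N * t n) ≤ N / 2 := by
    have h1 : ∑ j ∈ Finset.range N, w j * (C₁ + ∑' n : ℕ, g j n) ≤ ∑ j ∈ Finset.range N, w j * (1 / 2) :=
      Finset.sum_le_sum fun j _ => mul_le_mul_of_nonneg_left (key j).2 (hw0 j)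
    rw [← Finset.sum_mul, hsumw] at h1
    have h2 : ∑ j ∈ Finset.range N, w j * (C₁ + ∑' n : ℕ, g j n) =
        N * C₁ + ∑' n : ℕ, ∑ j ∈ Finset.range N, w j * g j n := by
      simp_rw [mul_add]
      rw [Finset.sum_add_distrib, ← Finset.sum_mul, hsumw]
      congr 1
      simp_rw [← tsum_mul_left]
      exact (Summable.tsum_finsetSum (fun j _ => (key j).1.mul_left (w j))).symm
    rw [h2] at h1
    simp_rw [hG] at h1
    linarith
  have hstar : C₁ - (1 / 2) * ∑' n : ℕ, Y n - ∑' n : ℕ, t n ≤ 1 / 2 := by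
    have h1 : ∑' n : ℕ, (-((N : ℝ) / 2) * Y n - N * t n) = -((N : ℝ) / 2) * ∑' n : ℕ, Y n - N * ∑' n : ℕ, t n := by
      rw [(hYs.mul_left _).tsum_sub (hts.mul_left _), tsum_mul_left, tsum_mul_left]
    rw [h1] at hcomb
    have h2 : (N : ℝ) * (C₁ - (1 / 2) * ∑' n : ℕ, Y n - ∑' n : ℕ, t n) ≤ N * (1 / 2) := by linarith
    exact le_of_mul_le_mul_left h2 hN0
  -- (v) the class-one series: primes of `D` against the pollution
  set e : ℕ → ℝ := fun n => if n ∈ D then (Real.log n - c n) / (2 * Real.sqrt n) else 0 with hedef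
  set r : ℕ → ℝ := fun n => if (((∃ q ∈ Q, q ∣ n) ∧ ((∀ q ∈ Q \ D, ¬ q ∣ n) ∧ (∀ p ∈ D, ¬ p ^ 2 ∣ n)) ∧
      (D.filter (· ∣ n)).card = 1) ∧ n ∉ D) then c n / n * P n else 0 with hrdef
  have hYer : ∀ n, -Y n = e n - r n := by
    intro n
    by_cases hnD : n ∈ D
    · obtain ⟨htouch, hsurv, hfil⟩ := prime_class_facts hQ hDQ hnD
      have hnP : n.Prime := hQ n (hDQ hnD)
      have hcond : (∃ q ∈ Q, q ∣ n) ∧ ((∀ q ∈ Q \ D, ¬ q ∣ n) ∧ (∀ p ∈ D, ¬ p ^ 2 ∣ n)) ∧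
          (D.filter (· ∣ n)).card = 1 := ⟨htouch, hsurv, by rw [hfil, Finset.card_singleton]⟩
      have hPn : P n = Real.sqrt n / 2 := by simp only [hP, hfil, Finset.prod_singleton]
      have hc' : ¬ (((∃ q ∈ Q, q ∣ n) ∧ ((∀ q ∈ Q \ D, ¬ q ∣ n) ∧ (∀ p ∈ D, ¬ p ^ 2 ∣ n)) ∧
          (D.filter (· ∣ n)).card = 1) ∧ n ∉ D) := fun h => h.2 hnD
      have hr : r n = 0 := by simp only [hrdef, if_neg hc']
      simp only [hYdef, hedef, if_pos hcond, if_pos hnD, hr, sub_zero, hPn,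
        ArithmeticFunction.vonMangoldt_apply_prime hnP]
      have hn0 : (0 : ℝ) < n := by exact_mod_cast hnP.pos
      have hs0 : 0 < Real.sqrt n := Real.sqrt_pos.2 hn0
      have hsq : Real.sqrt n ^ 2 = n := Real.sq_sqrt hn0.le
      field_simp
      rw [hsq]
      ring
    · have he : e n = 0 := by simp only [hedef, if_neg hnD]
      by_cases hcond : (∃ q ∈ Q, q ∣ n) ∧ ((∀ q ∈ Q \ D, ¬ q ∣ n) ∧ (∀ p ∈ D, ¬ p ^ 2 ∣ n)) ∧
          (D.filter (· ∣ n)).card = 1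
      · have hΛ : ArithmeticFunction.vonMangoldt n = 0 :=
          vonMangoldt_eq_zero_of_class_one hQ hDQ hcond.2.1 hcond.2.2 hnD
        simp only [hYdef, hrdef, if_pos hcond, if_pos (show _ ∧ n ∉ D from ⟨hcond, hnD⟩), he, hΛ, sub_zero,
          zero_sub]
      · have hc' : ¬ (((∃ q ∈ Q, q ∣ n) ∧ ((∀ q ∈ Q \ D, ¬ q ∣ n) ∧ (∀ p ∈ D, ¬ p ^ 2 ∣ n)) ∧
            (D.filter (· ∣ n)).card = 1) ∧ n ∉ D) := fun h => hcond h.1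
        simp only [hYdef, hrdef, if_neg hcond, if_neg hc', he, neg_zero, sub_zero]
  have hes : Summable e := summable_of_ne_finset_zero (s := D) (fun n hn => if_neg hn)
  have hrs : Summable r := by
    have : r = fun n => e n + Y n := by funext n; linarith [hYer n]
    rw [this]; exact hes.add hYs
  have hetsum : ∑' n : ℕ, e n = ∑ p ∈ D, (Real.log p - c p) / (2 * Real.sqrt p) := by
    rw [tsum_eq_sum (s := D) (fun n hn => if_neg hn)]
    exact Finset.sum_congr rfl fun p hp => if_pos hp
  have hYtsum : ∑' n : ℕ, Y n = ∑' n : ℕ, r n - ∑' n : ℕ, e n := by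
    rw [← hrs.tsum_sub hes]
    congr 1; funext n; linarith [hYer n]
  -- (vi) the pollution bound
  have hr0 : ∀ n, 0 ≤ r n := fun n => by
    simp only [hrdef]; split_ifs
    · exact mul_nonneg (div_nonneg (hc0 n) (Nat.cast_nonneg _)) (hP0 n)
    · exact le_rfl
  have hx0 : ∀ p n, 0 ≤ (if p ∣ n ∧ ¬ p ^ 2 ∣ n ∧ n ≠ p ∧ (∀ q ∈ Q, q ∣ n → q = p) then c n / (n : ℝ) else 0) :=
    fun p n => by split_ifs <;> [exact div_nonneg (hc0 n) (Nat.cast_nonneg _); exact le_rfl]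
  have hrle : ∀ n, r n ≤ ∑ p ∈ D, Real.sqrt p / 2 *
      (if p ∣ n ∧ ¬ p ^ 2 ∣ n ∧ n ≠ p ∧ (∀ q ∈ Q, q ∣ n → q = p) then c n / n else 0) := by
    intro n
    by_cases hcond : ((∃ q ∈ Q, q ∣ n) ∧ ((∀ q ∈ Q \ D, ¬ q ∣ n) ∧ (∀ p ∈ D, ¬ p ^ 2 ∣ n)) ∧
        (D.filter (· ∣ n)).card = 1) ∧ n ∉ D
    · obtain ⟨p₀, hp₀⟩ := Finset.card_eq_one.1 hcond.1.2.2
      have hp₀A : p₀ ∈ D.filter (· ∣ n) := by rw [hp₀]; exact Finset.mem_singleton_self _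
      rw [Finset.mem_filter] at hp₀A
      have hx : (if p₀ ∣ n ∧ ¬ p₀ ^ 2 ∣ n ∧ n ≠ p₀ ∧ (∀ q ∈ Q, q ∣ n → q = p₀) then c n / (n : ℝ) else 0) = c n / n := by
        refine if_pos ⟨hp₀A.2, hcond.1.2.1.2 p₀ hp₀A.1, fun h => hcond.2 (h ▸ hp₀A.1), fun q hq hqn => ?_⟩
        by_cases hqD : q ∈ D
        · have : q ∈ D.filter (· ∣ n) := Finset.mem_filter.2 ⟨hqD, hqn⟩
          rw [hp₀] at this
          exact Finset.mem_singleton.1 this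
        · exact absurd hqn (hcond.1.2.1.1 q (Finset.mem_sdiff.2 ⟨hq, hqD⟩))
      have hPn : P n = Real.sqrt p₀ / 2 := by simp only [hP, hp₀, Finset.prod_singleton]
      have hrn : r n = Real.sqrt p₀ / 2 *
          (if p₀ ∣ n ∧ ¬ p₀ ^ 2 ∣ n ∧ n ≠ p₀ ∧ (∀ q ∈ Q, q ∣ n → q = p₀) then c n / (n : ℝ) else 0) := by
        rw [hx]; simp only [hrdef, if_pos hcond, hPn]; ring
      rw [hrn]
      exact Finset.single_le_sum (f := fun p : ℕ => Real.sqrt p / 2 *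
        (if p ∣ n ∧ ¬ p ^ 2 ∣ n ∧ n ≠ p ∧ (∀ q ∈ Q, q ∣ n → q = p) then c n / (n : ℝ) else 0))
        (fun p _ => mul_nonneg (by positivity) (hx0 p n)) hp₀A.1
    · have : r n = 0 := by simp only [hrdef, if_neg hcond]
      rw [this]
      exact Finset.sum_nonneg fun p _ => mul_nonneg (by positivity) (hx0 p n)
  have hXsum : Summable (fun n : ℕ => ∑ p ∈ D, Real.sqrt p / 2 *
      (if p ∣ n ∧ ¬ p ^ 2 ∣ n ∧ n ≠ p ∧ (∀ q ∈ Q, q ∣ n → q = p) then c n / n else 0)) :=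
    summable_sum fun p hp => (hXs p hp).mul_left _
  have hrtsum : ∑' n : ℕ, r n ≤ ∑ p ∈ D, Real.sqrt p / 2 *
      ∑' n : ℕ, (if p ∣ n ∧ ¬ p ^ 2 ∣ n ∧ n ≠ p ∧ (∀ q ∈ Q, q ∣ n → q = p) then c n / n else 0) := by
    have h1 := hrs.tsum_le_tsum hrle hXsum
    rw [Summable.tsum_finsetSum (fun p hp => (hXs p hp).mul_left _)] at h1
    simp_rw [tsum_mul_left] at h1
    exact h1
  -- (vii) conclusion
  rw [hYtsum, hetsum] at hstar
  have hfin : ∑ p ∈ D, (Real.log p - c p) / Real.sqrt p =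
      2 * ∑ p ∈ D, (Real.log p - c p) / (2 * Real.sqrt p) := by
    rw [Finset.mul_sum]
    refine Finset.sum_congr rfl fun p hp => ?_
    have : 0 < Real.sqrt p := Real.sqrt_pos.2 (by exact_mod_cast (hQ p (hDQ hp)).pos)
    field_simp
  rw [hfin]
  have h2 : 2 * ∑ p ∈ D, Real.sqrt p / 2 *
      ∑' n : ℕ, (if p ∣ n ∧ ¬ p ^ 2 ∣ n ∧ n ≠ p ∧ (∀ q ∈ Q, q ∣ n → q = p) then c n / n else 0) =
      ∑ p ∈ D, Real.sqrt p *
        ∑' n : ℕ, (if p ∣ n ∧ ¬ p ^ 2 ∣ n ∧ n ≠ p ∧ (∀ q ∈ Q, q ∣ n → q = p) then c n / n else 0) := by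
    rw [Finset.mul_sum]; exact Finset.sum_congr rfl fun p _ => by ring
  nlinarith [hrtsum, htle, hstar, h2]

/-- **Registered sub-goal `designDeficitLevel`** (seat-0 anchor of this file, design algebra §3 Step 2 of the proof of
`stub_designOfTypes`): rotated killer/excluder designs + discrete Fejér give, for finite sets of primes `D ⊆ Q`,
`Σ_{p∈D} (log p − c(p))/√p ≤ 12 − 24 C₁ + Σ_{p∈D} √p · X_p(Q)`. [folklore] -/
theorem designDeficitLevel : ∀ c : ℕ → ℝ, (∀ n, 0 ≤ c n) →
    (∀ p : ℕ, p.Prime → Summable (fun n : ℕ => if p ∣ n then c n / n else 0)) →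
    (∀ α : ℕ → ℂ, ∀ L : ℕ, (∀ m, L < m → α m = 0) →
      ∃ T : ℝ, Filter.Tendsto (fun x : ℝ => ∑ n ∈ Finset.Icc 1 ⌊x⌋₊,
          (c n - ArithmeticFunction.vonMangoldt n) / n *
            (∑ ℓ ∈ Finset.Icc 1 L, ∑ ℓ' ∈ Finset.Icc 1 L, α ℓ * (starRingEnd ℂ) (α ℓ') *
            (((Nat.gcd (n * ℓ') ℓ : ℕ) : ℝ) : ℂ) / (Real.sqrt ((ℓ : ℝ) * ℓ') : ℂ)).re) Filter.atTop (nhds T) ∧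
        T ≤ 1 / 2 * (∑ ℓ ∈ Finset.Icc 1 L, ∑ ℓ' ∈ Finset.Icc 1 L, α ℓ * (starRingEnd ℂ) (α ℓ') *
            (((Nat.gcd (1 * ℓ') ℓ : ℕ) : ℝ) : ℂ) / (Real.sqrt ((ℓ : ℝ) * ℓ') : ℂ)).re) →
    ∀ C₁ : ℝ, Filter.Tendsto (fun x : ℝ => ∑ n ∈ Finset.Icc 1 ⌊x⌋₊,
        (c n - ArithmeticFunction.vonMangoldt n) / n) Filter.atTop (nhds C₁) → C₁ ≤ 1 / 2 →
    ∀ Q D : Finset ℕ, (∀ q ∈ Q, q.Prime) → D ⊆ Q →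
    ∑ p ∈ D, (Real.log p - c p) / Real.sqrt p ≤
      12 - 24 * C₁ + ∑ p ∈ D, Real.sqrt p *
        ∑' n : ℕ, (if p ∣ n ∧ ¬ p ^ 2 ∣ n ∧ n ≠ p ∧ (∀ q ∈ Q, q ∣ n → q = p) then c n / n else 0) :=
  fun c hc0 hLoc hTI C₁ hC₁ hC₁le Q D hQ hDQ => deficit_finset_le_level c hc0 hLoc hTI C₁ hC₁ hC₁le Q D hQ hDQ

end Design

end Summit.RiemannHypothesis.RiemannHypothesis.Theorems.SignConeConeMagnification
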